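import Summits.AtomisticToContinuum.Crystallization.Theorems.FrustratedLawDichotomyStrainedPatchKernelCutA
import Summits.AtomisticToContinuum.Crystallization.Theorems.FrustratedLawDichotomyStrainedPatchRecutChart

/-!
# Strained patch — «AffineCut»: the AFFINE balanced refit at the graded junction, in closed form
# (27623 strained-patch piece, T-side; decomp-a2c lens-5 generation 103, DOOR Tᴬ; tree-only imports)

(Imports the tree's `…StrainedPatchKernelCutA` — (R) `BalancedRefit`, `BalPred`, `rotBalanced`, `BalLE` — and `…StrainedPatchRecutChart` — the g54 recut machinery
`RecutOf`, `idxOf`, `exists_recut`'s lemmas, `ChartFamilyRW`, `CompFamilyW`/`compFamilyW`.)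

THE FINDING THIS NODE ANSWERS (memo NODE-g103 «COND-103»).  The supplier of (R𝓑) asked for in critic row 1635 — a least-squares refit over a window-honest BENT family
delivering balance against the 57 bent modes (`δQ`, `δC` included) — is ILL-CONDITIONED at the junction's coarse tolerance `τ₀ = 1/25`: the worst case over the
`τ₀`-tube of the refit's cubic drift is `≈ 5·10⁻³` (100× the cubic box of `𝓑₀`), its quadratic drift `≈ 4–8·10⁻³` (10× the gap `𝓑₁ ∖ 𝓑₀`), the chart ball moves by
`0.17–0.5 = 4–12 τ₀` and the host rim at `133/10` by `> 1`; no window-honest `τ₁ ≤ 4τ₀` supplier exists as a ∀-statement (desk table, `g103/num`).  The AFFINE part alone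
is well-conditioned and UNIVERSAL over the host box: worst-case drift `‖A_LS‖ ≤ κ·τ₀` with `κ ∈ [0.389, 0.403]` for fcc/hcp and every strain `‖G − 1‖ ≤ 0.18`
(`kdir103.py`), i.e. `‖A_LS‖ ≤ 0.0161 < 3/160`; and an affine map moves bond lengths RELATIVELY (`≤ 1/50`), so the g54 recut machinery applies verbatim once re-pinned
from `‖A‖ ≤ 1/150` to `‖A‖ ≤ 1/50` (§3: conjugate bend still in `𝓑₁`, matrix box `≤ 1/4`, skeleton window `68/5`, bent window `16`, separation `(49/50)(3/4) ≥ 7/10`).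

THE MOVE.  ★ `affBal r` — AFFINE MOMENT BALANCE on the `r`-ball: `Σ_{a ∈ B(c,r)} ⟨dev a, L (z₀ (e a) − z₀ c₀)⟩ = 0` for EVERY linear `L` (rotations AND strains; the
tree's `rotBalanced r` is its skew part, `balLE_affBal_rot`; it is the `uncapped ↦ ball r` transcription of g54's `projectedFree` normal equations).  The balance
is delivered EXACTLY and IN CLOSED FORM — no compactness, no minimiser, no first-order condition: with `X := Σ x_a ⊗ x_a` (host second moment of the labelled ball),
`Y` a symmetric inverse of `X` and `T := Σ_b d_b ⊗ (Y x_b)` (`lsMat`), the corrected field `d_a − T x_a` is affinely balanced (★★ `lsMat_balanced`, pure algebra), and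
`‖T‖ ≤ τ₀·κ` whenever `Σ_b |⟨Y x_b, u⟩| ≤ κ‖u‖` (★ `norm_lsMat_le`).  The recut of the coarse host by `A := T` (g54: conjugate bend, re-enumerated `133/10`-window,
labels through the skeleton) then charts the cluster GRADEDLY — coarse `4/25 = 4τ₀ ≥ τ₀ + (3/160)(63/10 + τ₀)` (the tree's advertised refit pin), table `affTol (1/25) (1/52)`: `τ₀ + ‖z₁ b − z₁ c₁‖/52` — and
is affinely balanced on the SAME ball, because the recut relabels by `1 + A` (`dev₁ = d − A x`, design `(1+A) x`; ★★ `chartByG_recutA`).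

THE PIECES (all generic in `(ρ, ε, η₂, T₀, r)`; no zone / sector literal enters — the sector predicates of the consumer live on the target side, memo «SECTOR-103»):
* ★ **(ROOMᴬ) `MomentRoom 𝓘₀ r κ τ₀ T₀`** [HOST GEOMETRY · INSTRUMENTABLE per host box; ONE constant `κ`] — for every coarse graded chart the second moment `X` of the
  labelled `r`-ball vectors has a symmetric inverse `Y` with `Σ_a |⟨Y x_a, u⟩| ≤ κ‖u‖`.  Record `κ = 15/32`; desk value of the sharp constant `0.389–0.403`
  (fcc/hcp, strain box `±0.18`, `r = 24/5`), so the drift constant is `κτ₀ ≤ 0.0161 ≤ 3/160 = (15/32)τ₀`.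
* ★ **(GOODᴬ) `RecutGoodA 𝓘₀ η₁`** [KINEMATIC · host-side] — every centre-keeping recut (`RecutOf A`, `‖A‖ ≤ 3/160`) of a host of `𝓘₀` has an `η₁`-good centre (= g54's
  (R7) at the larger matrix radius).  At `η₁ = η₃₀ = 7/100` (target `𝓘₁ʷ = CompFamilyW` EXACTLY) this is census GOOD-103; at `η₁ = 11/100` it follows from the tree's
  transport `…RecutLevelA.goodAtScale_recut` (`(1/16 + (2 + 1/16)(3/160))/(1 − 3/160) = 0.1031`) under the shell-gap columns — not typed here.
* ★★★ **`balancedRefit_affBal_of_room`** — `𝓘_N ≤ 𝓘₀ᴿʷ ∧ (ROOMᴬ)_κ ∧ κ ≤ 15/32 ∧ (GOODᴬ)_η₁ ∧ r ≤ 63/10 ⟹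
  BalancedRefit 𝓘_N (compFamilyW 𝓑₁ η₁) (affBal r) ρ ε η₂ (1/25) T₀ (4/25) (affTol (1/25) (1/52))`; record ★★★ `balancedRefit_affBal_record` at
  `(26/5, 1/100, 1/8, constTol (1/25))`, `r = 24/5`, `η₁ = η₃₀`: target `CompFamilyW` EXACTLY; ★★ `balancedRefit_rot_record`: the tree's advertised piece (R) at
  `(rotBalanced (24/5), τ₁ = 4τ₀)` (g86 `…KernelCutA`: «ATTACKABLE · KNOWN-MATH») follows (`balLE_affBal_rot`).
No sorry, no new axioms, no cite tokens, no instances / notation.  `--supports stmt-AtomisticToContinuum-27623`.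

SPLIT EDITION (hand-2 g43 landing lane; the node sha16 260721d31e01af32 is 522 l > the gate's 400-l cap for files with proofs): THIS FILE = part 1/2 = §0–§3 verbatim
(pins + graded table of the affine refit, affine moment balance, the normal equations in closed form, the host-side pieces (ROOMᴬ)/(GOODᴬ)); part 2/2 =
`…StrainedPatchAffineCut` (imports this file) = §4–§6 verbatim (the g54 recut re-pinned at ‖A‖ ≤ 1/50, the supplier of (R), the record junction).  Declarations,
statements and proofs byte-identical to the node; only the file boundary, the re-opened namespace/opens of part 2 and this note are new.
-/

noncomputable section

namespace Summit.AtomisticToContinuum.Crystallization.Theorems.FrustratedLawDichotomyStrainedPatchAffineCut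

open scoped BigOperators Classical RealInnerProductSpace
open Summit.AtomisticToContinuum.Crystallization.Theorems.ChargedEnergyGapNegative (E3)
open Summit.AtomisticToContinuum.Crystallization.Theorems.FrustratedLawDichotomyRangeCut (Sep)
open Summit.AtomisticToContinuum.Crystallization.Theorems.FrustratedLawDichotomyMotifLemmas (GoodAtScale)
open Summit.AtomisticToContinuum.Crystallization.Theorems.FrustratedLawDichotomyAveragingCut (ball mem_ball)
open Summit.AtomisticToContinuum.Crystallization.Theorems.FrustratedLawDichotomyStrainedPatchHomSplit
open Summit.AtomisticToContinuum.Crystallization.Theorems.FrustratedLawDichotomyStrainedPatchCleanCollar (CleanBall)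
open Summit.AtomisticToContinuum.Crystallization.Theorems.FrustratedLawDichotomyStrainedPatchPhaseCut (MonoPhaseBall)
open Summit.AtomisticToContinuum.Crystallization.Theorems.FrustratedLawDichotomyStrainedPatchCoreTube (NearHomIsoAt)
open Summit.AtomisticToContinuum.Crystallization.Theorems.FrustratedLawDichotomyStrainedPatchChartFamilies (ChartBy FamilyLE)
open Summit.AtomisticToContinuum.Crystallization.Theorems.FrustratedLawDichotomyStrainedPatchChartFamiliesBent
open Summit.AtomisticToContinuum.Crystallization.Theorems.FrustratedLawDichotomyStrainedPatchChartFamiliesPinned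
open Summit.AtomisticToContinuum.Crystallization.Theorems.FrustratedLawDichotomyStrainedPatchEnvelopeLaw (dev bends1)
open Summit.AtomisticToContinuum.Crystallization.Theorems.FrustratedLawDichotomyStrainedPatchQuantSlaving (ChartFam SlackTab)
open Summit.AtomisticToContinuum.Crystallization.Theorems.FrustratedLawDichotomyStrainedPatchGradedTube
open Summit.AtomisticToContinuum.Crystallization.Theorems.FrustratedLawDichotomyStrainedPatchWindowFamilies
open Summit.AtomisticToContinuum.Crystallization.Theorems.FrustratedLawDichotomyStrainedPatchRecutPairs
open Summit.AtomisticToContinuum.Crystallization.Theorems.FrustratedLawDichotomyStrainedPatchRecutKinematics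
open Summit.AtomisticToContinuum.Crystallization.Theorems.FrustratedLawDichotomyStrainedPatchRecutBuild
open Summit.AtomisticToContinuum.Crystallization.Theorems.FrustratedLawDichotomyStrainedPatchRecutRecord
open Summit.AtomisticToContinuum.Crystallization.Theorems.FrustratedLawDichotomyStrainedPatchRecutChart
open Summit.AtomisticToContinuum.Crystallization.Theorems.FrustratedLawDichotomyStrainedPatchKernelCut

/-! ## §0. Pins and the graded table of the affine refit -/

/-- The matrix radius of the affine refit: `‖A‖ ≤ 3/160` (`= κτ₀` at `κ = 15/32`, `τ₀ = 1/25`; the §4 kinematics is pinned at the rounder `1/50 ≥ 3/160`). -/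
def alphaA : ℝ := 3 / 160

/-- The coarse tolerance of the refit chart: `4/25 = 4τ₀ ≥ 1/25 + (3/160)(63/10 + 1/25) = 0.1588…` — the tree's advertised refit pin (g86 `…KernelCutA`, (R) at `τ₁ = 4τ₀`). -/
def tauA : ℝ := 4 / 25

/-- ★ `affTol τ κ` — the AFFINELY GRADED table `τ + κ·‖z₀ b − z₀ c₀‖` (the refit's deviation at a site is the coarse one plus `‖A‖` times the host radius). -/
def affTol (τ κ : ℝ) : SlackTab := fun _ z₀ c₀ b => τ + κ * dist (z₀ b) (z₀ c₀)

/-- `affTol` evaluates as stated. [formal bookkeeping] -/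
theorem affTol_apply (τ κ : ℝ) (M₀ : ℕ) (z₀ : Fin M₀ → E3) (c₀ b : Fin M₀) : affTol τ κ M₀ z₀ c₀ b = τ + κ * dist (z₀ b) (z₀ c₀) := rfl

/-! ## §1. ★ Affine moment balance -/

/-- ★ **`affBal r`** [THE BALANCE of DOOR Tᴬ] — the chart's deviation field on the `r`-ball has vanishing first moment against the host vectors in EVERY linear direction:
`Σ_{a ∈ B(c,r)} ⟨dev a, L (z₀ (e a) − z₀ c₀)⟩ = 0` for all `L : E3 →L[ℝ] E3` (the normal equations of the least-squares AFFINE fit `x ↦ (1+A)x`; rotations = skew `L`,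
strains = symmetric `L`). -/
def affBal (r : ℝ) : BalPred := fun _ z c _ z₀ c₀ e =>
  ∀ L : E3 →L[ℝ] E3, ∑ a ∈ ball r z c, ⟪dev z c z₀ c₀ e a, L (z₀ (e a) - z₀ c₀)⟫ = 0

/-- ★ Affine balance refines the tree's rotation balance (`so(3) ⊆ gl(3)`). [formal bookkeeping] -/
theorem balLE_affBal_rot (r : ℝ) : BalLE (affBal r) (rotBalanced r) := by
  intro M z c M₀ z₀ c₀ e h A _
  have h' := h (LinearMap.toContinuousLinearMap A)
  simpa only [LinearMap.coe_toContinuousLinearMap'] using h'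

/-- `affBal` refines `balTop`. [formal bookkeeping] -/
theorem balLE_affBal_top (r : ℝ) : BalLE (affBal r) balTop := balLE_top _

/-! ## §2. ★★ The normal equations in closed form -/

section LeastSquares

variable {ι : Type*} (s : Finset ι) (x d : ι → E3)

/-- `momX s x` — the SECOND MOMENT `X u = Σ_{b ∈ s} ⟨x_b, u⟩ x_b` of the design vectors. -/
def momX : E3 →L[ℝ] E3 := ∑ b ∈ s, (innerSL ℝ (x b)).smulRight (x b)

/-- `lsMat s x d Y` — the LEAST-SQUARES MATRIX `T u = Σ_{b ∈ s} ⟨x_b, Y u⟩ d_b` (`= D ∘ Y`, `D = Σ d_b ⊗ x_b`; with `Y = X⁻¹` it is THE minimiser of `Σ ‖d_b − T x_b‖²`). -/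
def lsMat (Y : E3 →L[ℝ] E3) : E3 →L[ℝ] E3 := ∑ b ∈ s, ((innerSL ℝ (x b)).comp Y).smulRight (d b)

variable {s x d}

/-- `momX` evaluates as stated. [formal bookkeeping] -/
theorem momX_apply (u : E3) : momX s x u = ∑ b ∈ s, ⟪x b, u⟫ • x b := by
  rw [momX, sum_apply]
  simp only [ContinuousLinearMap.smulRight_apply, innerSL_apply_apply]

/-- `lsMat` evaluates as stated. [formal bookkeeping] -/
theorem lsMat_apply (Y : E3 →L[ℝ] E3) (u : E3) : lsMat s x d Y u = ∑ b ∈ s, ⟪x b, Y u⟫ • d b := by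
  rw [lsMat, sum_apply]
  simp only [ContinuousLinearMap.smulRight_apply, ContinuousLinearMap.comp_apply, innerSL_apply_apply]

/-- The reproduction identity: for a symmetric `Y` with `X ∘ Y = 1`, `Σ_a ⟨x_b, Y x_a⟩ x_a = x_b`. [formal bookkeeping] -/
theorem sum_inner_smul_eq {Y : E3 →L[ℝ] E3} (hXY : ∀ u, momX s x (Y u) = u) (hYs : ∀ u v : E3, ⟪Y u, v⟫ = ⟪u, Y v⟫) (b : ι) :
    ∑ a ∈ s, ⟪x b, Y (x a)⟫ • x a = x b := by
  have h : ∀ a, ⟪x b, Y (x a)⟫ = ⟪x a, Y (x b)⟫ := fun a => by rw [← hYs, real_inner_comm]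
  simp_rw [h]
  rw [← momX_apply]
  exact hXY (x b)

/-- ★★ **THE NORMAL EQUATIONS, SOLVED** — for a symmetric `Y` with `X ∘ Y = 1` the corrected field `d_a − T x_a`, `T = lsMat s x d Y`, is AFFINELY BALANCED against the
design: `Σ_a ⟨d_a − T x_a, L x_a⟩ = 0` for every linear `L`.  (Pure algebra: `Σ_a ⟨T x_a, L x_a⟩ = Σ_b ⟨d_b, L (Σ_a ⟨x_b, Y x_a⟩ x_a)⟩ = Σ_b ⟨d_b, L x_b⟩`.) [folklore] -/
theorem lsMat_balanced {Y : E3 →L[ℝ] E3} (hXY : ∀ u, momX s x (Y u) = u) (hYs : ∀ u v : E3, ⟪Y u, v⟫ = ⟪u, Y v⟫) (L : E3 →L[ℝ] E3) :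
    ∑ a ∈ s, ⟪d a - lsMat s x d Y (x a), L (x a)⟫ = 0 := by
  have hT : ∀ a, ⟪lsMat s x d Y (x a), L (x a)⟫ = ∑ b ∈ s, ⟪x b, Y (x a)⟫ * ⟪d b, L (x a)⟫ := fun a => by
    rw [lsMat_apply, sum_inner]
    simp only [real_inner_smul_left]
  have hswap : ∑ a ∈ s, ⟪lsMat s x d Y (x a), L (x a)⟫ = ∑ b ∈ s, ⟪d b, L (x b)⟫ := by
    simp_rw [hT]
    rw [Finset.sum_comm]
    refine Finset.sum_congr rfl fun b _ => ?_
    have hL : L (∑ a ∈ s, ⟪x b, Y (x a)⟫ • x a) = ∑ a ∈ s, ⟪x b, Y (x a)⟫ • L (x a) := by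
      rw [map_sum]
      simp only [map_smul]
    calc ∑ a ∈ s, ⟪x b, Y (x a)⟫ * ⟪d b, L (x a)⟫ = ⟪d b, ∑ a ∈ s, ⟪x b, Y (x a)⟫ • L (x a)⟫ := by
          rw [inner_sum]; simp only [real_inner_smul_right]
      _ = ⟪d b, L (x b)⟫ := by rw [← hL, sum_inner_smul_eq hXY hYs b]
  simp only [inner_sub_left, Finset.sum_sub_distrib, hswap, sub_self]

/-- ★ **THE DRIFT BOUND** — if `‖d_b‖ ≤ τ` on `s` and `Σ_b |⟨Y x_b, u⟩| ≤ κ‖u‖` (`Y` symmetric), then `‖lsMat s x d Y‖ ≤ τ·κ`. [folklore] -/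
theorem norm_lsMat_le {Y : E3 →L[ℝ] E3} (hYs : ∀ u v : E3, ⟪Y u, v⟫ = ⟪u, Y v⟫) {τ κ : ℝ} (hτ : 0 ≤ τ) (hκ : 0 ≤ κ) (hd : ∀ b ∈ s, ‖d b‖ ≤ τ)
    (hY : ∀ u, ∑ b ∈ s, |⟪Y (x b), u⟫| ≤ κ * ‖u‖) : ‖lsMat s x d Y‖ ≤ τ * κ := by
  refine ContinuousLinearMap.opNorm_le_bound _ (mul_nonneg hτ hκ) fun u => ?_
  rw [lsMat_apply]
  calc ‖∑ b ∈ s, ⟪x b, Y u⟫ • d b‖ ≤ ∑ b ∈ s, ‖⟪x b, Y u⟫ • d b‖ := norm_sum_le _ _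
    _ = ∑ b ∈ s, |⟪Y (x b), u⟫| * ‖d b‖ := by
        refine Finset.sum_congr rfl fun b _ => ?_
        rw [norm_smul, Real.norm_eq_abs, ← hYs, real_inner_comm]
    _ ≤ ∑ b ∈ s, |⟪Y (x b), u⟫| * τ := Finset.sum_le_sum fun b hb => mul_le_mul_of_nonneg_left (hd b hb) (abs_nonneg _)
    _ = τ * ∑ b ∈ s, |⟪Y (x b), u⟫| := by rw [← Finset.sum_mul, mul_comm]
    _ ≤ τ * (κ * ‖u‖) := mul_le_mul_of_nonneg_left (hY u) hτ
    _ = τ * κ * ‖u‖ := by ring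

end LeastSquares

/-! ## §3. ★ The two host-side pieces: (ROOMᴬ) and (GOODᴬ) -/

/-- ★ **(ROOMᴬ)_κ `MomentRoom 𝓘₀ r κ τ₀ T₀`** [HOST GEOMETRY of the labelled ball · INSTRUMENTABLE per host box · ONE constant] — for every coarse graded chart (binders of
(R)) the second moment `X = Σ_{a ∈ B(c,r)} x_a ⊗ x_a` of the host vectors `x_a = z₀ (e a) − z₀ c₀` has a SYMMETRIC INVERSE `Y` (`X ∘ Y = 1`) with the directional
`ℓ¹` bound `Σ_a |⟨Y x_a, u⟩| ≤ κ‖u‖`.  Then the least-squares matrix has `‖A_LS‖ ≤ κ·τ₀` (`norm_lsMat_le`).  Record `κ = 15/32` (desk: `0.389–0.403` over fcc/hcp and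
the strain box `‖G − 1‖ ≤ 0.18` at `r = 24/5`; the crude `Σ‖x_a‖/λ_min(X) ≈ 0.78` would NOT do). -/
def MomentRoom (𝓘₀ : ChartFam) (r κ τ₀ : ℝ) (T₀ : SlackTab) : Prop :=
  ∀ (M : ℕ) (z : Fin M → E3) (c : Fin M) (M₀ : ℕ) (z₀ : Fin M₀ → E3) (c₀ : Fin M₀) (e : Fin M → Fin M₀),
    Admissible M z c → CleanBall (63 / 10) z c → MonoPhaseBall (63 / 10) z c → ChartByG 𝓘₀ τ₀ T₀ z c z₀ c₀ e →
      ∃ Y : E3 →L[ℝ] E3, (∀ u, momX (ball r z c) (fun a => z₀ (e a) - z₀ c₀) (Y u) = u) ∧ (∀ u v : E3, ⟪Y u, v⟫ = ⟪u, Y v⟫) ∧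
        ∀ u, ∑ a ∈ ball r z c, |⟪Y (z₀ (e a) - z₀ c₀), u⟫| ≤ κ * ‖u‖

/-- (ROOMᴬ) is monotone in `κ` and antitone in the family. [formal bookkeeping] -/
theorem MomentRoom.mono {𝓘₀ 𝓘₀' : ChartFam} (hle : FamilyLE 𝓘₀ 𝓘₀') {r κ κ' τ₀ : ℝ} {T₀ : SlackTab} (hκ : κ ≤ κ') (h : MomentRoom 𝓘₀' r κ τ₀ T₀) :
    MomentRoom 𝓘₀ r κ' τ₀ T₀ := by
  intro M z c M₀ z₀ c₀ e hz hcl hm hch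
  obtain ⟨Y, hXY, hYs, hY⟩ := h M z c M₀ z₀ c₀ e hz hcl hm (hch.mono_family hle)
  exact ⟨Y, hXY, hYs, fun u => (hY u).trans (mul_le_mul_of_nonneg_right hκ (norm_nonneg _))⟩

/-- ★ **(GOODᴬ)_η₁ `RecutGoodA 𝓘₀ η₁`** [KINEMATIC · host-side · INSTRUMENTABLE on (host box) × (‖A‖ ≤ 3/160)] — every centre-keeping recut `RecutOf A` (g54) of a host of `𝓘₀` by a
matrix `‖A‖ ≤ 3/160` has an `η₁`-good centre at scale `3/2` (= g54's (R7) at the larger matrix radius; `η₁ = 7/100` is census GOOD-103, `η₁ = 11/100` is the tree's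
transport `goodAtScale_recut` under the shell-gap columns). -/
def RecutGoodA (𝓘₀ : ChartFam) (η₁ : ℝ) : Prop :=
  ∀ (M₀ : ℕ) (z₀ : Fin M₀ → E3) (c₀ : Fin M₀), 𝓘₀ M₀ z₀ c₀ → ∀ A : E3 →L[ℝ] E3, ‖A‖ ≤ 3 / 160 →
    ∀ (M₁ : ℕ) (z₁ : Fin M₁ → E3) (c₁ : Fin M₁) (M : ℕ) (e₀ : Fin M → Fin M₀) (e₁ : Fin M → Fin M₁), RecutOf A z₀ c₀ z₁ c₁ e₀ e₁ → z₁ c₁ = z₀ c₀ →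
      GoodAtScale η₁ (3 / 2) z₁ c₁

/-- (GOODᴬ) is antitone in the family. [formal bookkeeping] -/
theorem RecutGoodA.anti {𝓘₀ 𝓘₀' : ChartFam} (hle : FamilyLE 𝓘₀ 𝓘₀') {η₁ : ℝ} (h : RecutGoodA 𝓘₀' η₁) : RecutGoodA 𝓘₀ η₁ :=
  fun M₀ z₀ c₀ hI => h M₀ z₀ c₀ (hle M₀ z₀ c₀ hI)

end Summit.AtomisticToContinuum.Crystallization.Theorems.FrustratedLawDichotomyStrainedPatchAffineCut

end
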